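import Literature.NumberTheory.Sieve.Maynard2016Prop94QuadFormBound
import Literature.NumberTheory.Sieve.Maynard2016Prop94KDimSum
import Literature.NumberTheory.Sieve.Maynard2016Prop94Expansion
import Literature.NumberTheory.Sieve.Maynard2016Prop94Reindex
import Literature.NumberTheory.Sieve.Maynard2016Prop94Totient
import Literature.NumberTheory.Sieve.Maynard2016Prop94ErrorTerm
import Literature.NumberTheory.Sieve.FGKMT2018MainTermPrefactor
import Literature.NumberTheory.Sieve.FGKMT2018LocalClassCount
import Literature.NumberTheory.Sieve.Maynard2016Lemma82
import Literature.NumberTheory.Sieve.FGKMT2018Section8Scalars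
import Literature.NumberTheory.Sieve.FGKMT2018SingularSeriesConvergence
import HarnessLib

/-!
# Maynard (2016), Proposition 9.4 over `𝒜 = ℤ` — the assembly (E2b leaf `prop94Z`)

Source: J. Maynard, *Dense clusters of primes in subsets*, Compositio Math. 152 (2016) =
arXiv:1405.2593 [Maynard2016DenseClusters], Proposition 9.4 with proof pp. 25–26
(= [FordGreenKonyaginMaynardTao2018, Thm 6 (7.14)] for `𝒜 = ℤ`, where no level-of-distribution
input is needed: residue classes in a dyadic interval are counted exactly).

The chain (P94-SPEC §1i): with `W = wCut k B`, `R₀ = X^{1/30}`, `Δ = Δ_L`, `M = W·B·Δ`,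
1. majorant `1_{L₀(n) prime > R₀} w_n ≤ S₀⁻² g(n) w_n` (`indicator_prime_coprime_le`);
2. expansion + class count for the coupled `(k+1)`-dimensional system
   (`abs_sum_oneDimSq_mul_sieveWt_sub_le`): `Σ g w = #𝒜 (φ_{ω⁺}(W)/W) Q⁺ + O(φ_{ω⁺}(W)(Σ|λ|)²(Σ|λ̃|)²)`;
3. `Q⁺` reindexed by the Option box (`quadFormPlus_eq_sum4`) and diagonalised:
   `|Q⁺| ≤ 4¹³² S₀ S_A` (`abs_quadFormPlus_le`), `S_A ≤ K₅ P (log R)^k I_k(F)` (Lemma 8.4,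
   `prop94_kdimSum_frame`);
4. `S₀⁻¹ ≤ (M/φ(M))/log R₀` (`log_le_mul_S0`), `φ_{ω⁺}(W) ≤ φ_ω(W) ∏_{p∣W, p∤Δ}(1 − 1/p)`
   (`phiOmega_cons_le_mul_prod`), `(M/φ(M)) ∏_{p∣W,p∤Δ}(1 − 1/p) ≤ (B/φ(B)) (Δ/φ(Δ))`
   (`div_totient_mul_prod_le`), `(φ_ω(W)/W) P = (B/φ(B))^k 𝔖_B(𝓛)` (`mainTerm_prefactor_eq`),
   `log R ≤ (10/3) log R₀`, `B/φ(B) ≤ 2`;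
5. the error is `≤ S₀² errTermB` (`prop94_error_frame`).
The real arithmetic of 3–5 is isolated in `prop94_arith`.
-/

namespace Literature.NumberTheory.Sieve

open Finset Real Filter

namespace FGKMT2018

/-- The real arithmetic of the assembly of Prop. 9.4: from the expansion inequality
`Σgw − #𝒜 φ⁺/W · Q ≤ φ⁺ E`, `Q ≤ 4¹³² S₀ S_A`, `S_A ≤ K₅ P (log R)^k I`, the error bound
`φ⁺E ≤ S₀² err`, `log R₀ ≤ (M/φ(M)) S₀`, `φ⁺ ≤ φ_ω PiW`, `(M/φ(M)) PiW ≤ (B/φ(B)) (Δ/φ(Δ))`,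
`(φ_ω/W) P = (B/φ(B))^k 𝔖`, `log R ≤ (10/3) log R₀`, `B/φ(B) ≤ 2` one gets
`S₀⁻² Σgw ≤ (4¹³² K₅ · 20/3 + 1) (Δ/φ(Δ)) err` with `err = (B/φ(B))^k SB #𝒜 (log R)^{k−1} I`.
[cite: Maynard2016DenseClusters, proof of Prop. 9.4 p. 26 (final display); FordGreenKonyaginMaynardTao2018, Thm 6 (7.14) pp. 21–22] -/
theorem prop94_arith {k : ℕ} (hk : 1 ≤ k)
    {Sgw A φp φw Wr Q E P SA S₀ lR lR₀ IF K₅ MφM PiW bφ bφk SB ΔφΔ c₄ : ℝ} (hc₄ : 0 ≤ c₄)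
    (h2 : Sgw - A * φp / Wr * Q ≤ φp * E) (h4 : Q ≤ c₄ * S₀ * SA)
    (hSA : SA ≤ K₅ * (P * (lR ^ k * IF)))
    (hE : φp * E ≤ S₀ ^ 2 * (bφk * SB * A * lR ^ (k - 1) * IF))
    (hS : lR₀ ≤ MφM * S₀) (hφ : φp ≤ φw * PiW) (hPi : MφM * PiW ≤ bφ * ΔφΔ)
    (hpref : φw / Wr * P = bφk * SB) (hlR : lR ≤ 10 / 3 * lR₀) (hbφ : bφ ≤ 2)
    (hA : 0 ≤ A) (hφp : 0 ≤ φp) (hWr : 0 < Wr) (hP : 0 ≤ P) (hS₀ : 1 ≤ S₀) (hIF : 0 ≤ IF)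
    (hSB : 0 ≤ SB) (hbφk : 0 ≤ bφk) (hlR0 : 0 ≤ lR) (hPiW : 0 ≤ PiW)
    (hΔ : 1 ≤ ΔφΔ) (hK₅ : 0 ≤ K₅) :
    S₀⁻¹ ^ 2 * Sgw ≤
      (c₄ * K₅ * (20 / 3) + 1) * ΔφΔ * (bφk * SB * A * lR ^ (k - 1) * IF) := by
  set err : ℝ := bφk * SB * A * lR ^ (k - 1) * IF with herr
  have herr0 : 0 ≤ err := by positivity
  have hS₀0 : 0 < S₀ := by linarith
  have hs0 : 0 ≤ S₀⁻¹ := inv_nonneg.2 hS₀0.le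
  have hWr0 : Wr ≠ 0 := hWr.ne'
  have hlk : lR ^ k = lR ^ (k - 1) * lR := by
    rw [← pow_succ, Nat.sub_add_cancel hk]
  -- (a) insert the bounds for `Q` and `S_A`
  set Main : ℝ := A * φp / Wr * (c₄ * S₀ * (K₅ * (P * (lR ^ k * IF)))) with hMain
  have hQ' : Q ≤ c₄ * S₀ * (K₅ * (P * (lR ^ k * IF))) :=
    h4.trans (mul_le_mul_of_nonneg_left hSA (by positivity))
  have h1 : Sgw ≤ Main + S₀ ^ 2 * err := by
    have := mul_le_mul_of_nonneg_left hQ' (show 0 ≤ A * φp / Wr by positivity)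
    linarith
  have ha : S₀⁻¹ ^ 2 * Sgw ≤ S₀⁻¹ ^ 2 * Main + err := by
    have e : S₀⁻¹ ^ 2 * (S₀ ^ 2 * err) = err := by field_simp
    calc S₀⁻¹ ^ 2 * Sgw ≤ S₀⁻¹ ^ 2 * (Main + S₀ ^ 2 * err) :=
          mul_le_mul_of_nonneg_left h1 (by positivity)
      _ = S₀⁻¹ ^ 2 * Main + err := by rw [mul_add, e]
  -- (b) regroup the main term
  have hb : S₀⁻¹ ^ 2 * Main =
      c₄ * K₅ * (A * IF) * (φp * (P / Wr)) * lR ^ (k - 1) * (lR * S₀⁻¹) := by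
    rw [hMain, hlk]
    field_simp
  -- (c) `φ⁺ · P/W ≤ PiW · (B/φ(B))^k 𝔖_B`
  have hc : φp * (P / Wr) ≤ PiW * (bφk * SB) := by
    calc φp * (P / Wr) ≤ φw * PiW * (P / Wr) :=
          mul_le_mul_of_nonneg_right hφ (div_nonneg hP hWr.le)
      _ = PiW * (φw / Wr * P) := by ring
      _ = PiW * (bφk * SB) := by rw [hpref]
  -- (d) `log R · S₀⁻¹ ≤ (10/3) · M/φ(M)`
  have hd : lR * S₀⁻¹ ≤ 10 / 3 * MφM := by
    have h1 : lR₀ * S₀⁻¹ ≤ MφM := by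
      calc lR₀ * S₀⁻¹ ≤ MφM * S₀ * S₀⁻¹ := mul_le_mul_of_nonneg_right hS hs0
        _ = MφM := by rw [mul_assoc, mul_inv_cancel₀ hS₀0.ne', mul_one]
    calc lR * S₀⁻¹ ≤ 10 / 3 * lR₀ * S₀⁻¹ := mul_le_mul_of_nonneg_right hlR hs0
      _ = 10 / 3 * (lR₀ * S₀⁻¹) := by ring
      _ ≤ 10 / 3 * MφM := mul_le_mul_of_nonneg_left h1 (by norm_num)
  -- (e) combine
  have hcP : 0 ≤ PiW * (bφk * SB) := by positivity
  have he : S₀⁻¹ ^ 2 * Main ≤ c₄ * K₅ * (20 / 3) * ΔφΔ * err := by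
    rw [hb]
    calc c₄ * K₅ * (A * IF) * (φp * (P / Wr)) * lR ^ (k - 1) * (lR * S₀⁻¹)
        ≤ c₄ * K₅ * (A * IF) * (PiW * (bφk * SB)) * lR ^ (k - 1) * (10 / 3 * MφM) := by
          apply mul_le_mul _ hd (by positivity) (by positivity)
          exact mul_le_mul_of_nonneg_right
            (mul_le_mul_of_nonneg_left hc (by positivity)) (by positivity)
      _ = c₄ * K₅ * (10 / 3) * (MφM * PiW) * err := by rw [herr]; ring
      _ ≤ c₄ * K₅ * (10 / 3) * (bφ * ΔφΔ) * err := by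
          apply mul_le_mul_of_nonneg_right _ herr0
          exact mul_le_mul_of_nonneg_left hPi (by positivity)
      _ ≤ c₄ * K₅ * (10 / 3) * (2 * ΔφΔ) * err := by
          apply mul_le_mul_of_nonneg_right _ herr0
          exact mul_le_mul_of_nonneg_left
            (mul_le_mul_of_nonneg_right hbφ (by linarith)) (by positivity)
      _ = c₄ * K₅ * (20 / 3) * ΔφΔ * err := by ring
  have hf : err ≤ ΔφΔ * err := le_mul_of_one_le_left herr0 hΔ
  calc S₀⁻¹ ^ 2 * Sgw ≤ S₀⁻¹ ^ 2 * Main + err := ha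
    _ ≤ c₄ * K₅ * (20 / 3) * ΔφΔ * err + ΔφΔ * err := add_le_add he hf
    _ = (c₄ * K₅ * (20 / 3) + 1) * ΔφΔ * err := by ring

end FGKMT2018

open FGKMT2018 in
/-- **[Maynard2016DenseClusters, Prop. 9.4] for `𝒜 = ℤ`** (= [FGKMT, Thm 6 (7.14)]; the E2b leaf
`Maynard2016DenseClusters_prop94Z`): for `L₀ = a₀n + b₀ ∉ 𝓛` with `a₀ ≠ 0` and
`Δ_L = |a₀| ∏_j |a₀b_j − a_jb₀| ≠ 0`, in the frame of Prop. 6.1,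
`Σ_{n ∈ 𝒜(x), L₀(n) prime > X^{1/30}} w_n ≤ K (Δ_L/φ(Δ_L)) (B/φ(B))^k 𝔖_B(𝓛) #𝒜(x) (log R)^{k−1} I_k(F)`.
Proof: the `(k+1)`-dimensional Selberg upper-bound sieve of pp. 25–26 (majorant by the coupled weights
`λ_d λ̃_{d₀}`, class count with `ω⁺`, diagonalisation, Lemma 8.4 for the `k`-dimensional sum, the
one-dimensional sum `≪ S₀`, `S₀ ≥ (φ(M)/M) log R₀`, and the negligible error term) — see the module
docstring for the lemma chain; `K = 4¹³²·K₅·20/3 + 1` with `K₅` the constant of `prop94_kdimSum_frame`.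
[cite: Maynard2016DenseClusters, Prop. 9.4 with proof pp. 25–26; FordGreenKonyaginMaynardTao2018, Thm 6 (7.14) pp. 21–22] -/
theorem maynard2016DenseClusters_prop94Z_holds : Maynard2016DenseClusters_prop94Z := by
  classical
  obtain ⟨C₅, K₅, hK₅, h₅⟩ := FGKMT2018.prop94_kdimSum_frame
  obtain ⟨C₆, h₆⟩ := FGKMT2018.prop94_error_frame
  refine ⟨max (max C₅ C₆) 262144, 4 ^ 132 * K₅ * (20 / 3) + 1, by positivity, ?_⟩
  have h56 := h₅.and h₆
  unfold FGKMT2018.Prop61Frame at h56 ⊢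
  filter_upwards [h56, FGKMT2018.eventually_prop94_aux] with x hx haux B hB hBx k L X R hCk hk
    hadm hnd hcoef hX1 hX2 hR1 hR2 l₀ ha₀ _hb₁ _hb₂ hres
  have hC56 : max C₅ C₆ ≤ k := (le_max_left _ _).trans hCk
  have hk18 : 262144 ≤ k := (le_max_right _ _).trans hCk
  obtain ⟨hSA, hErr⟩ := hx B hB hBx k L X R hC56 hk hadm hnd hcoef hX1 hX2 hR1 hR2
  obtain ⟨hXone, hlX1, h2k, hR₀1, hR1', hlogRR₀, -⟩ := haux k hk X R hX1 hR1 hR2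
  have hk2 : 2 ≤ k := le_trans (by norm_num) hk18
  have hk1 : 1 ≤ k := le_trans (by norm_num) hk18
  have hB0 : B ≠ 0 := hB.elim (fun h => by rw [h]; exact one_ne_zero) fun h => h.ne_zero
  have hX0 : 0 < X := by linarith
  have hR₀0 : (0 : ℝ) ≤ X ^ ((1 : ℝ) / 30) := by positivity
  have hlogR : 0 ≤ Real.log R := (Real.log_pos hR1').le
  -- the modulus `M = W·B·Δ_L` of the one-dimensional sieve
  have hΔ0 : discDelta L l₀ ≠ 0 := FGKMT2018.discDelta_ne_zero ha₀ hres
  have hW0 : wCut k B ≠ 0 := (FGKMT2018.squarefree_wCut k B).ne_zero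
  obtain ⟨M, hMdef⟩ : ∃ M : ℕ, M = wCut k B * B * discDelta L l₀ := ⟨_, rfl⟩
  have hM0 : M ≠ 0 := by rw [hMdef]; exact mul_ne_zero (mul_ne_zero hW0 hB0) hΔ0
  have hWM : wCut k B ∣ M := Dvd.intro (B * discDelta L l₀) (by rw [hMdef, mul_assoc])
  have hΔM : discDelta L l₀ ∣ M := Dvd.intro_left (wCut k B * B) hMdef.symm
  have hMp : ∀ p : ℕ, p.Prime → ¬ p ∣ M → 2 * k ^ 2 < p := fun p hp h =>
    FGKMT2018.two_mul_sq_lt_of_not_dvd_wCut_mul_mul (D := discDelta L l₀) hp (hMdef ▸ h)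
  have hWR₀ : ∀ p : ℕ, p.Prime → p ∣ wCut k B → (p : ℝ) ≤ X ^ ((1 : ℝ) / 30) :=
    fun p hp h => FGKMT2018.cast_le_of_dvd_wCut h2k hp h
  have hS₀1 : 1 ≤ SelbergBox.S0 M (X ^ ((1 : ℝ) / 30)) := SelbergBox.one_le_S0 hR₀1
  -- Step 1: the majorant `1_T(n) w_n ≤ S₀⁻² g(n) w_n`
  have h1 : ∑ n ∈ (dyadZ X).filter (fun n => 0 < formEval l₀ n ∧ (formEval l₀ n).natAbs.Prime ∧
        X ^ ((1 : ℝ) / 30) < (formEval l₀ n : ℝ)), sieveWt L B R (MaynardDense.F k) n ≤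
      (SelbergBox.S0 M (X ^ ((1 : ℝ) / 30)))⁻¹ ^ 2 *
        ∑ n ∈ dyadZ X, (if Int.gcd (formEval l₀ n) (wCut k B) = 1 then
          (∑ d₀ ∈ (SelbergBox.box₀ M (X ^ ((1 : ℝ) / 30))).filter
              (fun d₀ : ℕ => ((d₀ : ℕ) : ℤ) ∣ formEval l₀ n),
            SelbergBox.lamT M (X ^ ((1 : ℝ) / 30)) d₀) ^ 2 else 0) *
          sieveWt L B R (MaynardDense.F k) n := by
    rw [Finset.sum_filter, Finset.mul_sum]
    refine Finset.sum_le_sum fun n _ => ?_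
    have h := FGKMT2018.indicator_prime_coprime_le (M := M) hR₀1 hWR₀ (formEval l₀ n)
      (sieveWt_nonneg L B R (MaynardDense.F k) n)
    rw [mul_assoc] at h
    exact h
  -- Step 2: expansion + class count
  have h2 := (abs_le.1 (FGKMT2018.abs_sum_oneDimSq_mul_sieveWt_sub_le X hadm B R
    (MaynardDense.F k) l₀ hWM hΔM (X ^ ((1 : ℝ) / 30)))).2
  rw [sub_le_iff_le_add] at h2
  rw [← sub_le_iff_le_add] at h2
  -- Step 3: the quadratic form
  have h4 := FGKMT2018.abs_quadFormPlus_le hk2 hadm hR1'.le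
    (FGKMT2018.yPref_pos hadm hnd hk1 hB0).le hMp (X ^ ((1 : ℝ) / 30))
  rw [FGKMT2018.quadFormPlus_eq_sum4 L B R (MaynardDense.F k) M (X ^ ((1 : ℝ) / 30))] at h4
  have h4' := (le_abs_self _).trans h4
  -- Step 4/5: the remaining scalar facts
  have hErr' := hErr l₀ M
  simp only [FGKMT2018.errTermB] at hErr'
  have hS := SelbergBox.log_le_mul_S0 (R₀ := X ^ ((1 : ℝ) / 30)) hM0 hR₀0
  have hφ := FGKMT2018.phiOmega_cons_le_mul_prod hadm l₀ (wCut k B)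
  have hPi := FGKMT2018.div_totient_mul_prod_le hW0 hB0 hΔ0
  rw [← hMdef] at hPi
  have hpref := FGKMT2018.mainTerm_prefactor_eq hadm hnd B
  have hbφ := FGKMT2018.bOverPhi_le_two hB
  have hA : (0 : ℝ) ≤ (#(dyadZ X) : ℝ) := Nat.cast_nonneg _
  have hφp : 0 ≤ phiOmega (Fin.cons l₀ L : Fin (k + 1) → ℤ × ℤ) (wCut k B) := by
    rw [← FGKMT2018.cast_prod_sub_omegaL]; exact Nat.cast_nonneg _
  have hWr : (0 : ℝ) < (wCut k B : ℝ) := by exact_mod_cast Nat.pos_of_ne_zero hW0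
  have hP := (FGKMT2018.yPref_pos hadm hnd hk1 hB0).le
  have hIF : 0 ≤ MaynardDense.IF k := (MaynardDense.orthantI_F_pos hk18).le
  have hSB : 0 ≤ singSeriesExcl L B := (FGKMT2018.singSeriesExcl_pos_of_nondegenerate hadm hnd B).le
  have hbφk : 0 ≤ bOverPhi B ^ k := pow_nonneg (FGKMT2018.bOverPhi_nonneg B) k
  have hPiW : 0 ≤ ∏ p ∈ (wCut k B).primeFactors.filter (fun p => ¬ p ∣ discDelta L l₀),
      (1 - 1 / (p : ℝ)) := by
    refine Finset.prod_nonneg fun p hp => ?_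
    have hp := Nat.prime_of_mem_primeFactors (Finset.mem_filter.1 hp).1
    have hp0 : (0 : ℝ) < p := by exact_mod_cast hp.pos
    rw [sub_nonneg, div_le_one hp0]
    exact_mod_cast hp.one_lt.le
  have hΔ1 : (1 : ℝ) ≤ (discDelta L l₀ : ℝ) / (Nat.totient (discDelta L l₀) : ℝ) := by
    rw [one_le_div (by exact_mod_cast Nat.totient_pos.2 (Nat.pos_of_ne_zero hΔ0))]
    exact_mod_cast Nat.totient_le _
  have hfin := FGKMT2018.prop94_arith hk1 (by positivity : (0 : ℝ) ≤ (4 : ℝ) ^ 132) h2 h4' hSA hErr' hS hφ hPi hpref hlogRR₀ hbφ hA hφp hWr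
    hP hS₀1 hIF hSB hbφk hlogR hPiW hΔ1 hK₅.le
  simp only [FGKMT2018.errTermB]
  exact h1.trans hfin

/-- **`Maynard2016DenseClusters_prop94Z` holds** (Maynard 2016, Proposition 9.4 for `𝒜 = ℤ` at
`ξ = 1/30`, `D = 1`, in FGKMT's frame of Prop. 6.1 / Thm 6 (7.14)) — the exact-name `_holds` alias of
`maynard2016DenseClusters_prop94Z_holds` above (appended 2026-08-29, flt-inv gen 70; D-0026
bookkeeping: the proof term is the existing theorem of this file; no statement, definition or attribute
is edited; no new named fact; the ledger's debt table listed the fact unproved at +60 min,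
`ledger fact claim` GRANTED 2026-08-29T14:10Z).
[cite: Maynard2016DenseClusters, Prop. 9.4 pp. 24–26; FordGreenKonyaginMaynardTao2018, Thm 6 (7.14) p. 22] -/
theorem Maynard2016DenseClusters_prop94Z_holds :
    _root_.Literature.NumberTheory.Sieve.Maynard2016DenseClusters_prop94Z :=
  _root_.Literature.NumberTheory.Sieve.maynard2016DenseClusters_prop94Z_holds

end Literature.NumberTheory.Sieve
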